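import Mathlib
import HarnessLib
import Summits.NavierStokesRegularity.NavierStokesRegularity.Theorems.PoloidalWindowDoorLrcModEntireTwistingTHSlopeSlab
import Summits.NavierStokesRegularity.NavierStokesRegularity.Theorems.PoloidalWindowDoorLrcModEntireTwistingTHFlatRidgeSecantPin

/-!
# Item `LrcModEntire` (stmt-NavierStokesRegularity-20428) — THE FLAT SUB-CELL: the QUARTIC NORMAL FORM at a flat hot point, BY NAME and branch-free (memo T2B-g15 §17b)

ns-k2-port-2 g7, helper of item 20428 under LEAD ns-poloidal-K2-p3 g15 (`--supports stmt-NavierStokesRegularity-20428 --as helper`).  Memo `Cruxes/LrcModEntire/T2B-g15.md` §17b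
computes, in Fermi coordinates of a smooth flat branch, the quartic normal form `Q_s(n,z) = q[(n² + c₀z²)² + 4c₀z²n²] + b·zn(n² + c₀z²)` (`c₀ = −μ₀`) from the slice equation
`u_zz = c(z)Δₕu` and the vanishing 3-jet.  Here the same structure is typed POINTWISE at a flat hot point `y ∈ P₀`, with no branch:

1. the slab slice law: the (TH) slope `μ(t,x₂)` exists on a uniform slab `|x₂| < ρ` (`…TwistingTHSlopeSlab.exists_slopeFunction_slab`, port-2 g6) and incompressibility gives
   `∂₂∂₂θ(x) = −μ(−1,x₂)·Δₕθ(x)` on that slab (`…TimeHeightShearLinearSlice.plane_wave_identity`);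
2. class-free: `D²(m·L)(y) = m(y)·D²L(y)` when `L(y) = 0`, `DL(y) = 0` (`fderiv_fderiv_mul_of_flat`); at a flat hot point `Δₕθ(y) = 0` and `∇Δₕθ(y) = 0` (3-jet,
   `…FlatRidgeThirdJet`), so **`D²(∂₂²θ)(y) = −μ₀·D²(Δₕθ)(y)` as bilinear forms** (`hessian_vertVert_eq_smul_hessian_horizLaplacian_of_flatHotPoint`, `μ₀ ≤ 0` by
   `…TwistingTHSlopeSign.slopeFunction_nonpos`);
3. with the secant kernel `T` of `…FlatRidgeSecantPin.exists_secantKernel_of_flatHotPoint` and `ν = JT`: `D²(Δₕθ)(y)[c,d] = D⁴θ(y)[c,d,ν,ν]`, whence the NORMAL FORM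
   **`D⁴θ(y)[c,d,e₂,e₂] = −μ₀·D⁴θ(y)[c,d,ν,ν]` for all `c, d`**, and in particular `D⁴[ν,ν,e₂,e₂] = c₀·∂_ν⁴θ`, `D⁴[e₂,e₂,e₂,e₂] = c₀²·∂_ν⁴θ`,
   `D⁴[ν,e₂,e₂,e₂] = c₀·D⁴[ν,e₂,ν,ν]`, all `T`-slots zero (`quarticNormalForm_of_flatHotPoint`) — the memo's `(q, b, c₀)` structure of the binary quartic in `(n, z)`.

Currency: `D⁴θ(y)[c,d,a,b] := fderiv ℝ (fderiv ℝ (fun x => fderiv ℝ (fderiv ℝ θ) x a b)) y c d`, `θ := v₂(−1,·)` (as in `…FlatRidgeSecantPin`).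

WHAT THIS IS NOT: not a claim about Navier–Stokes regularity and not a proof of `stub_T2bFlat`; fourth-order point identities for the OPEN flat sub-cell (bears_on LADDER-NS N0,
item 20428 / crux 19708; OPEN).
-/

set_option linter.style.longLine false
set_option linter.dupNamespace false

namespace Summit.NavierStokesRegularity.NavierStokesRegularity.Theorems.PoloidalWindowDoorLrcModEntireTwistingTHFlatRidgeQuarticNormalForm

open Set Function Filter Topology Metric
open scoped RealInnerProductSpace InnerProductSpace ContDiff Laplacian
open Literature.Analysis Literature.Analysis.FluidPDE Literature.Analysis.UnboundedOperators
open Summit.NavierStokesRegularity.NavierStokesRegularity.Theorems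
open Summit.NavierStokesRegularity.NavierStokesRegularity.Theorems.LocalSineTubeDoorProfileAlignedWindowRigidityAncient
open Summit.NavierStokesRegularity.NavierStokesRegularity.Theorems.PoloidalWindowDoorPoloidalWindowRigidityWindow
open Summit.NavierStokesRegularity.NavierStokesRegularity.Theorems.PoloidalWindowDoorPoloidalWindowRigidityConstantShearSlice
open Summit.NavierStokesRegularity.NavierStokesRegularity.Theorems.PoloidalWindowDoorPoloidalWindowRigidityTimeHeightShearLinearSlice
open Summit.NavierStokesRegularity.NavierStokesRegularity.Theorems.PoloidalWindowDoorLrcModEntireRidgeWiring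
open Summit.NavierStokesRegularity.NavierStokesRegularity.Theorems.PoloidalWindowDoorLrcModEntireTwistingTHSlopeSign
open Summit.NavierStokesRegularity.NavierStokesRegularity.Theorems.PoloidalWindowDoorLrcModEntireTwistingTHNonflatPlane
open Summit.NavierStokesRegularity.NavierStokesRegularity.Theorems.PoloidalWindowDoorLrcModEntireTwistingTHSlopeSlab
open Summit.NavierStokesRegularity.NavierStokesRegularity.Theorems.PoloidalWindowDoorLrcModEntireTwistingTHFlatRidgeJet
open Summit.NavierStokesRegularity.NavierStokesRegularity.Theorems.PoloidalWindowDoorLrcModEntireTwistingTHFlatRidgeThirdJet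
open Summit.NavierStokesRegularity.NavierStokesRegularity.Theorems.PoloidalWindowDoorLrcModEntireTwistingTHFlatRidgeSecantPin

/-! ### Class-free: the Hessian of a product with a doubly vanishing factor -/

/-- **`D²(m·L)(y) = m(y)·D²L(y)` when `L(y) = 0` and `DL(y) = 0`** (`m, L ∈ C²` real functions on a normed space). [folklore] -/
theorem fderiv_fderiv_mul_of_flat {E : Type*} [NormedAddCommGroup E] [NormedSpace ℝ E] {m L : E → ℝ} (hm : ContDiff ℝ 2 m) (hL : ContDiff ℝ 2 L)
    {y : E} (hL0 : L y = 0) (hL1 : fderiv ℝ L y = 0) :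
    fderiv ℝ (fderiv ℝ (fun x => m x * L x)) y = m y • fderiv ℝ (fderiv ℝ L) y := by
  have hmd : Differentiable ℝ m := hm.differentiable (by norm_num)
  have hLd : Differentiable ℝ L := hL.differentiable (by norm_num)
  have hm2 : DifferentiableAt ℝ (fderiv ℝ m) y := ((hm.fderiv_right (m := 1) (by norm_num)).differentiable one_ne_zero) y
  have hL2 : DifferentiableAt ℝ (fderiv ℝ L) y := ((hL.fderiv_right (m := 1) (by norm_num)).differentiable one_ne_zero) y
  have hd1 : fderiv ℝ (fun x => m x * L x) = fun x => m x • fderiv ℝ L x + L x • fderiv ℝ m x :=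
    funext fun x => ((hmd x).hasFDerivAt.fun_mul (hLd x).hasFDerivAt).fderiv
  rw [hd1]
  have h := (((hmd y).hasFDerivAt.fun_smul hL2.hasFDerivAt).fun_add ((hLd y).hasFDerivAt.fun_smul hm2.hasFDerivAt)).fderiv
  rw [h, hL0, hL1]
  simp

variable {C : ℝ} {v : ℝ → EuclideanSpace ℝ (Fin 3) → EuclideanSpace ℝ (Fin 3)}

/-- **THE VERTICAL–VERTICAL HESSIAN BLOCK IS SLAVED TO THE HORIZONTAL LAPLACIAN at a flat hot point:** `∃ μ₀ ≤ 0`,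
`D²(x ↦ D²θ(x)[e₂][e₂])(y) = −μ₀ • D²(x ↦ D²θ(x)[e₀][e₀] + D²θ(x)[e₁][e₁])(y)` (`μ₀` = the (TH) slope on `P₀`).  Hypotheses of `…FlatRidgeJet.hessian_eq_zero_of_flatHotPoint` VERBATIM
plus poloidality. -/
theorem hessian_vertVert_eq_smul_hessian_horizLaplacian_of_flatHotPoint (hdec : HasTypeITimeDecay C v) (hcont : ContinuousOn (uncurry v) (Iio (0 : ℝ) ×ˢ univ))
    (hmild : ∀ s t : ℝ, s < t → t < 0 → ∀ x, v t x = heatExtension (v s) (t - s) x - oseenDuhamel 1 s v v t x)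
    (hdiv : ∀ t < 0, VectorCalculus.IsDivFree (v t))
    (hpol : ∀ s < 0, ∀ y, ⟪curl (v s) y, EuclideanSpace.single 2 1⟫_ℝ = 0)
    (hTH : ∀ t < 0, ∀ x x' : EuclideanSpace ℝ (Fin 3), x 2 = x' 2 → ∀ b c : Fin 3, b ≠ 2 → c ≠ 2 →
      fderiv ℝ (v t) x (EuclideanSpace.single 2 1) b * fderiv ℝ (v t) x' (EuclideanSpace.single c 1) 2 =
        fderiv ℝ (v t) x' (EuclideanSpace.single 2 1) c * fderiv ℝ (v t) x (EuclideanSpace.single b 1) 2)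
    (hne : v (-1) 0 2 ≠ 0) (hhot : ∀ t < 0, ∀ x, Real.sqrt (-t) * |v t x 2| ≤ |v (-1) 0 2|)
    (hproper : ∀ y ∈ {y : EuclideanSpace ℝ (Fin 3) | y 2 = 0 ∧ v (-1) y 2 = v (-1) 0 2}, ∀ r : ℝ, 0 < r →
      ∃ y' : EuclideanSpace ℝ (Fin 3), y' 2 = 0 ∧ dist y' y < r ∧ v (-1) y' 2 ≠ v (-1) 0 2)
    {σ : ℝ} (hσN : σ * v (-1) 0 2 = |v (-1) 0 2|)
    {y : EuclideanSpace ℝ (Fin 3)} (hy0 : y 2 = 0) (hy : v (-1) y 2 = v (-1) 0 2)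
    (hflat : fderiv ℝ (fderiv ℝ (fun x => σ * v (-1) x 2)) y (EuclideanSpace.single 0 1) (EuclideanSpace.single 0 1) +
      fderiv ℝ (fderiv ℝ (fun x => σ * v (-1) x 2)) y (EuclideanSpace.single 1 1) (EuclideanSpace.single 1 1) = 0) :
    ∃ μ₀ : ℝ, μ₀ ≤ 0 ∧
      fderiv ℝ (fderiv ℝ (fun x => fderiv ℝ (fderiv ℝ (fun x' => (v (-1) x' 2 : ℝ))) x (EuclideanSpace.single 2 1) (EuclideanSpace.single 2 1))) y =
        (-μ₀) • fderiv ℝ (fderiv ℝ (fun x => fderiv ℝ (fun x' => fderiv ℝ (fun y' => (v (-1) y' 2 : ℝ)) x' (EuclideanSpace.single 0 1)) x (EuclideanSpace.single 0 1) +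
          fderiv ℝ (fun x' => fderiv ℝ (fun y' => (v (-1) y' 2 : ℝ)) x' (EuclideanSpace.single 1 1)) x (EuclideanSpace.single 1 1))) y := by
  have h1 : (-1 : ℝ) < 0 := by norm_num
  have hA : IsTypeIAncientMild C v := isTypeIAncientMild_of_class hdec hcont hmild hdiv
  have hs : ContDiff ℝ ∞ (v (-1)) := hA.contDiff_slice h1
  have hsd : Differentiable ℝ (v (-1)) := hs.differentiable (by simp)
  set θ : EuclideanSpace ℝ (Fin 3) → ℝ := fun x => v (-1) x 2 with hθdef
  have hθ : ContDiff ℝ ∞ θ := contDiff_two_component hdec hcont hmild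
  have hθ2 : ContDiff ℝ 2 θ := hθ.of_le (by exact WithTop.coe_le_coe.2 le_top)
  have hθ3 : ContDiff ℝ 3 θ := hθ.of_le (by exact WithTop.coe_le_coe.2 le_top)
  -- ## the slope function on a uniform slab and its sign
  have h02 : (0 : EuclideanSpace ℝ (Fin 3)) 2 = 0 := rfl
  obtain ⟨y', hy'2, -, hy'ne⟩ := hproper 0 ⟨h02, rfl⟩ 1 one_pos
  obtain ⟨y₁, hy₁, c₁, hc₁, hne₁⟩ := exists_fderiv_two_ne_zero_of_properRidge hsd ⟨y', hy'2, hy'ne⟩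
  obtain ⟨μ, ρ, hρ, hμ3, hslab, hnear, -⟩ := exists_slopeFunction_slab hdec hcont hmild hTH hy₁ hc₁ hne₁
  have hμ0 : μ (-1) 0 ≤ 0 := slopeFunction_nonpos hdec hcont hmild hdiv hpol hne hhot hμ3.continuous (hnear 0 h02)
  refine ⟨μ (-1) 0, hμ0, ?_⟩
  -- ## the slab slice law `∂₂∂₂θ(x) = −μ(−1,x₂)·Δₕθ(x)` for `|x₂| < ρ`
  have hdivpt : ∀ x : EuclideanSpace ℝ (Fin 3), fderiv ℝ (v (-1)) x (EuclideanSpace.single 0 (1 : ℝ)) 0 +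
      fderiv ℝ (v (-1)) x (EuclideanSpace.single 1 (1 : ℝ)) 1 + fderiv ℝ (v (-1)) x (EuclideanSpace.single 2 (1 : ℝ)) 2 = 0 :=
    fun x => div_coord (hdiv (-1) h1) x
  set L : EuclideanSpace ℝ (Fin 3) → ℝ := fun x => fderiv ℝ (fun x' => fderiv ℝ θ x' (EuclideanSpace.single 0 1)) x (EuclideanSpace.single 0 1) +
    fderiv ℝ (fun x' => fderiv ℝ θ x' (EuclideanSpace.single 1 1)) x (EuclideanSpace.single 1 1) with hLdef
  set m : EuclideanSpace ℝ (Fin 3) → ℝ := fun x => -μ (-1) (x 2) with hmdef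
  have hlaw : ∀ x : EuclideanSpace ℝ (Fin 3), |x 2| < ρ →
      fderiv ℝ (fun x' => fderiv ℝ θ x' (EuclideanSpace.single 2 1)) x (EuclideanSpace.single 2 1) = m x * L x := by
    intro x hx
    have hslope : ∀ w : EuclideanSpace ℝ (Fin 3), w 2 = x 2 → ∀ b : Fin 3, b ≠ 2 →
        fderiv ℝ (v (-1)) w (EuclideanSpace.single 2 (1 : ℝ)) b = μ (-1) (x 2) * fderiv ℝ (v (-1)) w (EuclideanSpace.single b (1 : ℝ)) 2 := by
      intro w hw b hb
      have h := hslab (-1) (by norm_num; exact hρ) w (by rw [hw]; exact hx) b hb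
      rw [hw] at h
      exact h
    have h := plane_wave_identity (hs.of_le (by norm_cast)) hdivpt hslope (rfl : x 2 = x 2)
    rw [hmdef, hLdef, hθdef]
    simp only
    exact h
  -- ## as an eventual identity near `y`
  have hU : {x : EuclideanSpace ℝ (Fin 3) | |x 2| < ρ} ∈ 𝓝 y := by
    have hc : Continuous fun x : EuclideanSpace ℝ (Fin 3) => |x 2| := ((EuclideanSpace.proj (2 : Fin 3)).continuous).abs
    exact (isOpen_lt hc continuous_const).mem_nhds (by show |y 2| < ρ; rw [hy0, abs_zero]; exact hρ)
  have hev : (fun x => fderiv ℝ (fun x' => fderiv ℝ θ x' (EuclideanSpace.single 2 1)) x (EuclideanSpace.single 2 1)) =ᶠ[𝓝 y] fun x => m x * L x := by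
    filter_upwards [hU] with x hx using hlaw x hx
  -- ## regularity of `m` and `L`, and the flat data `L(y) = 0`, `DL(y) = 0`
  have hm : ContDiff ℝ 2 m := by
    have h1' : ContDiff ℝ 3 (fun x : EuclideanSpace ℝ (Fin 3) => μ (-1) (x 2)) :=
      hμ3.comp (contDiff_const.prodMk (EuclideanSpace.proj (𝕜 := ℝ) (2 : Fin 3)).contDiff)
    rw [hmdef]; exact (h1'.of_le (by norm_num)).neg
  have hsec : ∀ e : EuclideanSpace ℝ (Fin 3), ContDiff ℝ 2 (fun x => fderiv ℝ (fun x' => fderiv ℝ θ x' e) x e) := fun e =>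
    ((((hθ.fderiv_right (m := ∞) (by norm_cast)).clm_apply contDiff_const).fderiv_right (m := ∞) (by norm_cast)).clm_apply contDiff_const).of_le
      (by exact WithTop.coe_le_coe.2 le_top)
  have hLc : ContDiff ℝ 2 L := by rw [hLdef]; exact (hsec _).add (hsec _)
  have hH := hessian_two_eq_zero_of_flatHotPoint hdec hcont hmild hdiv hTH hne hhot hproper hσN hy0 hy hflat
  have h3 := thirdDeriv_two_eq_zero_of_flatHotPoint hdec hcont hmild hdiv hTH hne hhot hproper hσN hy0 hy hflat
  have hentry0 : ∀ e : EuclideanSpace ℝ (Fin 3), fderiv ℝ (fun x' => fderiv ℝ θ x' e) y e = 0 := fun e => by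
    rw [← fderiv_fderiv_eq_coord hθ2 y e e, hθdef, hH]; simp
  have hentry1 : ∀ e : EuclideanSpace ℝ (Fin 3), fderiv ℝ (fun x => fderiv ℝ (fun x' => fderiv ℝ θ x' e) x e) y = 0 := fun e => by
    ext w
    have hF : ContDiff ℝ 2 (fun x' => fderiv ℝ θ x' e) := (hθ3.fderiv_right (m := 2) (by norm_num)).clm_apply contDiff_const
    rw [← fderiv_fderiv_eq_coord hF y w e, fderiv_fderiv_fderiv_apply_eq hθ3 y w e e, hθdef, h3]
    simp
  have hL0 : L y = 0 := by rw [hLdef]; simp only; rw [hentry0, hentry0, add_zero]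
  have hL1 : fderiv ℝ L y = 0 := by
    have hd : ∀ e, DifferentiableAt ℝ (fun x => fderiv ℝ (fun x' => fderiv ℝ θ x' e) x e) y := fun e => ((hsec e).differentiable (by norm_num)) y
    rw [hLdef, fderiv_fun_add (hd _) (hd _), hentry1, hentry1, add_zero]
  -- ## conclude
  have hlhs : (fun x => fderiv ℝ (fderiv ℝ θ) x (EuclideanSpace.single 2 1) (EuclideanSpace.single 2 1)) =
      fun x => fderiv ℝ (fun x' => fderiv ℝ θ x' (EuclideanSpace.single 2 1)) x (EuclideanSpace.single 2 1) :=
    funext fun x => fderiv_fderiv_eq_coord hθ2 x _ _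
  rw [hθdef] at hlhs
  rw [hlhs, (hev.fderiv (𝕜 := ℝ)).fderiv_eq (𝕜 := ℝ), fderiv_fderiv_mul_of_flat hm hLc hL0 hL1]
  rw [hmdef, hLdef, hθdef]
  simp only [hy0]

/-- **THE QUARTIC NORMAL FORM at a flat hot point (memo T2B-g15 §17b), branch-free.**  At a hot point `y ∈ P₀` of a `stub_T2bFlat` profile (flat law at every hot point of `P₀`,
«no compact isolated hot piece», poloidality, (TH), hot-spot normalisation, `hproper`) there are `μ₀ ≤ 0`, a unit horizontal `T` (a limit of unit hot secants) and `ν := JT` with,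
writing `D⁴[c,d,a,b] := D²(x ↦ D²θ(x)[a][b])(y)[c][d]`, `θ = v₂(−1,·)`:
(i) `D⁴[T,w,a,b] = 0` for all `a b w`;  (ii) `D⁴[c,d,e₂,e₂] = −μ₀·D⁴[c,d,ν,ν]` for all `c d`;  (iii) `D⁴[e₂,e₂,e₂,e₂] = μ₀²·D⁴[ν,ν,ν,ν]`.
So with `c₀ = −μ₀`, `P = ∂_ν⁴θ(y)`, `B₃ = D⁴[ν,e₂,ν,ν]`: the quartic form on `span(ν, e₂)` has exactly the coefficients `(P; 4B₃; 6c₀P; 4c₀B₃; c₀²P)` of the memo's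
`q[(n²+c₀z²)² + 4c₀z²n²] + b·zn(n²+c₀z²)`, and no `T`-dependence. -/
theorem quarticNormalForm_of_flatHotPoint (hdec : HasTypeITimeDecay C v) (hcont : ContinuousOn (uncurry v) (Iio (0 : ℝ) ×ˢ univ))
    (hmild : ∀ s t : ℝ, s < t → t < 0 → ∀ x, v t x = heatExtension (v s) (t - s) x - oseenDuhamel 1 s v v t x)
    (hdiv : ∀ t < 0, VectorCalculus.IsDivFree (v t))
    (hpol : ∀ s < 0, ∀ y, ⟪curl (v s) y, EuclideanSpace.single 2 1⟫_ℝ = 0)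
    (hTH : ∀ t < 0, ∀ x x' : EuclideanSpace ℝ (Fin 3), x 2 = x' 2 → ∀ b c : Fin 3, b ≠ 2 → c ≠ 2 →
      fderiv ℝ (v t) x (EuclideanSpace.single 2 1) b * fderiv ℝ (v t) x' (EuclideanSpace.single c 1) 2 =
        fderiv ℝ (v t) x' (EuclideanSpace.single 2 1) c * fderiv ℝ (v t) x (EuclideanSpace.single b 1) 2)
    (hne : v (-1) 0 2 ≠ 0) (hhot : ∀ t < 0, ∀ x, Real.sqrt (-t) * |v t x 2| ≤ |v (-1) 0 2|)
    (hproper : ∀ y ∈ {y : EuclideanSpace ℝ (Fin 3) | y 2 = 0 ∧ v (-1) y 2 = v (-1) 0 2}, ∀ r : ℝ, 0 < r →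
      ∃ y' : EuclideanSpace ℝ (Fin 3), y' 2 = 0 ∧ dist y' y < r ∧ v (-1) y' 2 ≠ v (-1) 0 2)
    (hni : ∀ K O : Set (EuclideanSpace ℝ (Fin 3)), IsCompact K → K.Nonempty → K ⊆ {y : EuclideanSpace ℝ (Fin 3) | y 2 = 0 ∧ v (-1) y 2 = v (-1) 0 2} →
      IsOpen O → K ⊆ O → O ∩ {y : EuclideanSpace ℝ (Fin 3) | y 2 = 0 ∧ v (-1) y 2 = v (-1) 0 2} ⊆ K → False)
    {σ : ℝ} (hσN : σ * v (-1) 0 2 = |v (-1) 0 2|)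
    (hflatAll : ∀ y : EuclideanSpace ℝ (Fin 3), y 2 = 0 → v (-1) y 2 = v (-1) 0 2 →
      fderiv ℝ (fderiv ℝ (fun x => σ * v (-1) x 2)) y (EuclideanSpace.single 0 1) (EuclideanSpace.single 0 1) +
        fderiv ℝ (fderiv ℝ (fun x => σ * v (-1) x 2)) y (EuclideanSpace.single 1 1) (EuclideanSpace.single 1 1) = 0)
    {y : EuclideanSpace ℝ (Fin 3)} (hy0 : y 2 = 0) (hy : v (-1) y 2 = v (-1) 0 2) :
    ∃ μ₀ : ℝ, μ₀ ≤ 0 ∧ ∃ T : EuclideanSpace ℝ (Fin 3), T 2 = 0 ∧ ‖T‖ = 1 ∧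
      (∀ a b w : EuclideanSpace ℝ (Fin 3), fderiv ℝ (fderiv ℝ (fun x => fderiv ℝ (fderiv ℝ (fun x' => (v (-1) x' 2 : ℝ))) x a b)) y T w = 0) ∧
      (∀ c d : EuclideanSpace ℝ (Fin 3),
        fderiv ℝ (fderiv ℝ (fun x => fderiv ℝ (fderiv ℝ (fun x' => (v (-1) x' 2 : ℝ))) x (EuclideanSpace.single 2 1) (EuclideanSpace.single 2 1))) y c d =
          (-μ₀) * fderiv ℝ (fderiv ℝ (fun x => fderiv ℝ (fderiv ℝ (fun x' => (v (-1) x' 2 : ℝ))) x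
            ((-T 1) • EuclideanSpace.single 0 (1 : ℝ) + T 0 • EuclideanSpace.single 1 (1 : ℝ))
            ((-T 1) • EuclideanSpace.single 0 (1 : ℝ) + T 0 • EuclideanSpace.single 1 (1 : ℝ)))) y c d) ∧
      fderiv ℝ (fderiv ℝ (fun x => fderiv ℝ (fderiv ℝ (fun x' => (v (-1) x' 2 : ℝ))) x (EuclideanSpace.single 2 1) (EuclideanSpace.single 2 1))) y
          (EuclideanSpace.single 2 1) (EuclideanSpace.single 2 1) =
        μ₀ ^ 2 * fderiv ℝ (fderiv ℝ (fun x => fderiv ℝ (fderiv ℝ (fun x' => (v (-1) x' 2 : ℝ))) x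
            ((-T 1) • EuclideanSpace.single 0 (1 : ℝ) + T 0 • EuclideanSpace.single 1 (1 : ℝ))
            ((-T 1) • EuclideanSpace.single 0 (1 : ℝ) + T 0 • EuclideanSpace.single 1 (1 : ℝ)))) y
          ((-T 1) • EuclideanSpace.single 0 (1 : ℝ) + T 0 • EuclideanSpace.single 1 (1 : ℝ))
          ((-T 1) • EuclideanSpace.single 0 (1 : ℝ) + T 0 • EuclideanSpace.single 1 (1 : ℝ)) := by
  set θ : EuclideanSpace ℝ (Fin 3) → ℝ := fun x => v (-1) x 2 with hθdef
  have hθ : ContDiff ℝ 4 θ := contDiff_two_component hdec hcont hmild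
  have hθ2 : ContDiff ℝ 2 θ := hθ.of_le (by norm_num)
  have hflat := hflatAll y hy0 hy
  obtain ⟨μ₀, hμ0, hvv⟩ := hessian_vertVert_eq_smul_hessian_horizLaplacian_of_flatHotPoint hdec hcont hmild hdiv hpol hTH hne hhot hproper hσN hy0 hy hflat
  obtain ⟨T, hT2, hT1, hker⟩ := exists_secantKernel_of_flatHotPoint hdec hcont hmild hdiv hTH hne hhot hproper hni hσN hflatAll hy0 hy
  set ν : EuclideanSpace ℝ (Fin 3) := (-T 1) • EuclideanSpace.single 0 (1 : ℝ) + T 0 • EuclideanSpace.single 1 (1 : ℝ) with hνdef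
  set e₂ : EuclideanSpace ℝ (Fin 3) := EuclideanSpace.single 2 1 with he₂
  -- ## the horizontal Laplacian's Hessian is the `(ν,ν)`-block: `D²(Δₕθ)(y)[c][d] = D⁴[c,d,ν,ν]`
  have htrace : (fun x => fderiv ℝ (fun x' => fderiv ℝ θ x' (EuclideanSpace.single 0 1)) x (EuclideanSpace.single 0 1) +
        fderiv ℝ (fun x' => fderiv ℝ θ x' (EuclideanSpace.single 1 1)) x (EuclideanSpace.single 1 1)) =
      fun x => fderiv ℝ (fderiv ℝ θ) x ν ν + fderiv ℝ (fderiv ℝ θ) x T T := by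
    funext x
    rw [← fderiv_fderiv_eq_coord hθ2 x, ← fderiv_fderiv_eq_coord hθ2 x]
    exact horizTrace_eq (fderiv ℝ (fderiv ℝ θ) x) hT2 hT1
  have hHνν : ContDiff ℝ 2 (fun x => fderiv ℝ (fderiv ℝ θ) x ν ν) := contDiff_hessianEntry hθ ν ν
  have hHTT : ContDiff ℝ 2 (fun x => fderiv ℝ (fderiv ℝ θ) x T T) := contDiff_hessianEntry hθ T T
  have hsplit : ∀ c d : EuclideanSpace ℝ (Fin 3),
      fderiv ℝ (fderiv ℝ (fun x => fderiv ℝ (fun x' => fderiv ℝ θ x' (EuclideanSpace.single 0 1)) x (EuclideanSpace.single 0 1) +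
        fderiv ℝ (fun x' => fderiv ℝ θ x' (EuclideanSpace.single 1 1)) x (EuclideanSpace.single 1 1))) y c d =
      fderiv ℝ (fderiv ℝ (fun x => fderiv ℝ (fderiv ℝ θ) x ν ν)) y c d := by
    intro c d
    rw [htrace]
    have hd1 : ∀ x, DifferentiableAt ℝ (fun x => fderiv ℝ (fderiv ℝ θ) x ν ν) x := fun x => (hHνν.differentiable (by norm_num)) x
    have hd2 : ∀ x, DifferentiableAt ℝ (fun x => fderiv ℝ (fderiv ℝ θ) x T T) x := fun x => (hHTT.differentiable (by norm_num)) x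
    have e1 : fderiv ℝ (fun x => fderiv ℝ (fderiv ℝ θ) x ν ν + fderiv ℝ (fderiv ℝ θ) x T T) =
        fderiv ℝ (fun x => fderiv ℝ (fderiv ℝ θ) x ν ν) + fderiv ℝ (fun x => fderiv ℝ (fderiv ℝ θ) x T T) := by
      funext x; exact fderiv_fun_add (hd1 x) (hd2 x)
    have hD1 : DifferentiableAt ℝ (fderiv ℝ (fun x => fderiv ℝ (fderiv ℝ θ) x ν ν)) y :=
      ((hHνν.fderiv_right (m := 1) (by norm_num)).differentiable one_ne_zero) y
    have hD2 : DifferentiableAt ℝ (fderiv ℝ (fun x => fderiv ℝ (fderiv ℝ θ) x T T)) y :=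
      ((hHTT.fderiv_right (m := 1) (by norm_num)).differentiable one_ne_zero) y
    rw [e1, fderiv_add hD1 hD2]
    simp only [add_apply]
    have hTT : fderiv ℝ (fderiv ℝ (fun x => fderiv ℝ (fderiv ℝ θ) x T T)) y c d = 0 := by
      rw [fourthDeriv_symm_middle hθ T T c d, fourthDeriv_symm_outer hθ d T c T]
      exact hker d T c
    rw [hTT, add_zero]
  -- ## (ii) the master identity
  have hii : ∀ c d : EuclideanSpace ℝ (Fin 3), fderiv ℝ (fderiv ℝ (fun x => fderiv ℝ (fderiv ℝ θ) x e₂ e₂)) y c d =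
      (-μ₀) * fderiv ℝ (fderiv ℝ (fun x => fderiv ℝ (fderiv ℝ θ) x ν ν)) y c d := by
    intro c d
    have h := congrArg (fun B : EuclideanSpace ℝ (Fin 3) →L[ℝ] EuclideanSpace ℝ (Fin 3) →L[ℝ] ℝ => B c d) hvv
    simp only [smul_apply, smul_eq_mul] at h
    rw [he₂, h, hsplit c d]
  refine ⟨μ₀, hμ0, T, hT2, hT1, hker, hii, ?_⟩
  -- ## (iii) `D⁴[e₂,e₂,e₂,e₂] = μ₀² D⁴[ν,ν,ν,ν]` via the symmetry chain `(e₂,e₂,ν,ν) → (ν,ν,e₂,e₂)`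
  have hsym : fderiv ℝ (fderiv ℝ (fun x => fderiv ℝ (fderiv ℝ θ) x ν ν)) y e₂ e₂ = fderiv ℝ (fderiv ℝ (fun x => fderiv ℝ (fderiv ℝ θ) x e₂ e₂)) y ν ν := by
    rw [fourthDeriv_symm_middle hθ ν ν e₂ e₂, fourthDeriv_symm_outer hθ e₂ ν e₂ ν, fourthDeriv_symm_inner hθ e₂ ν,
      fourthDeriv_symm_middle hθ ν e₂ ν e₂]
  rw [hii e₂ e₂, hsym, hii ν ν]
  ring

end Summit.NavierStokesRegularity.NavierStokesRegularity.Theorems.PoloidalWindowDoorLrcModEntireTwistingTHFlatRidgeQuarticNormalForm
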